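import Summits.QuantumFields.YangMills.Theorems.FlatTubeReductionBOAssemblySlowRate
import Summits.QuantumFields.YangMills.Theorems.LuscherReductionTwistedTraceScalingBOAssembly
import HarnessLib

/-!
# `BORateBricksD`: the rate-grade Born–Oppenheimer brick list WITHOUT `W ≤ 1`, WITH the DRESSED one-site no-intruder — g10 repair of `BORateBricks` (p651470) for `L ≥ 3`
# (route `FlatTubeReduction`, crux K1 `NearFlatRatioLaw` stmt-QuantumFields-24720; seat `ym-line-ftr-p1` g10; R2b1 RECORD rung — no summit statement is proved here)

g9's `BORateBricks` carries `hW1 : W ≤ 1` for the dressed one-site weight `W² = λ_fib(u)/λ_fib(1)`; its only use is the SLOW clause (`slow_rate_clause_of_bricks`: the UNDRESSED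
one-site inner rate applied to the dressed family, then `‖G_aW‖ ≤ ‖G_a‖`).  For `L ≥ 3` the fibre-only zero-point energy has NEGATIVE curvature at the vacuum (crux workfile
`Cruxes/NearFlatRatioLaw/Lines/ratepack-dressing-g10.md` §1: c_L = −0.36, −0.82, −1.60, −2.90 for L = 3, 4, 6, 10), so `W > 1` off the vacuum while (B-T)-rate pins `W²` to
that ratio: `BORateBricks L χ δ` is EMPTY for `L ≥ 3`.  THIS FILE is the repaired brick list: identical data and fields, except
* `W` is only measurable and BOUNDED (`hWb`; no sign condition, no `W ≤ 1`);
* NEW analytic field `hDS` — the DRESSED ONE-SITE NO-INTRUDER at rate grade, every level `k`: eventually in `β`, every admissible `(k+1)`-family `G` of bounded measurable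
  gauge-invariant one-site amplitudes supported in `{orbitDist < δ₁ β}` with nondegenerate dressed Gram matrix has `a ≠ 0` with
  `⟨G_aW, K_{L³β} G_aW⟩·μ₀ ≤ e^{C_D λ_b(L³β)²}·μ_k·μ₀·‖G_a‖²` (norm UNDRESSED) — replacing (`W ≤ 1` + `RateTube.oneOrbitRate_one`).  Its intended proof (memo §3): cluster
  absorption (crux ONE levels + `LuscherSimonGap_holds` + the exact physical eigenfamily with domination at `L = 1`, `PhysL2.exists_isPhys_eigenfamily_dominating`) + the new
  one-site input «second moments of the exact one-site eigenfunctions are `O(λ_b²)`»; it needs the window radius `δ₁ = O((L³β)^{-1/6})`.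
* `BORateBricksD L χ δ` (structure); the assembly `softTubeBORatePackageOn_of_rateBricksD` is the next file `…BOAssemblyRateD.lean`.
HONEST FRAMING: the analytic bricks (B-T)(B-ST)(B-OD)(B-N) at rate grade, `hTop` and `hDS` are OPEN fixed-lattice semiclassics (pooled with RED lane A's C4-CORE and crux ONE's
one-site machinery); this file is assembly algebra; femto rung R2b1 (RECORD label); not infinite volume, not a gap, not Clay.  One new `structure`, no named facts, no `sorry`.
-/

set_option autoImplicit false

noncomputable section

open MeasureTheory Filter Topology Real
open scoped BigOperators
open Literature.MathematicalPhysics.QuantumFieldTheory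
open Literature.MathematicalPhysics.QuantumLattice

namespace Summit.QuantumFields.YangMills.Theorems.FemtoTransferGap.RateTube

open Summit.QuantumFields.YangMills.Theorems.FemtoTransferGap
open Summit.QuantumFields.YangMills.Theorems.FemtoTransferGap.TwoLattice.Avg
open Summit.QuantumFields.YangMills.Theorems.FemtoTransferGap.TwoLattice.ConstTube
open Summit.QuantumFields.YangMills.Theorems.FemtoTransferGap.TwoLattice.Stiff (LinkSpace)

variable (L : ℕ) [NeZero L]

/-! ## §1 The rate-grade brick list -/

/-- **THE RATE-GRADE BORN–OPPENHEIMER BRICK LIST, DRESSED FORM** for a weight family `χ` and a test-support radius `δ` (g10 repair of `BORateBricks`: no `W ≤ 1`; the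
dressed one-site no-intruder `hDS` is a field): data (ADAPTED equivariant fibre profile `Ω β u v`, dressed one-site weight `W β u` — bounded, measurable, any sign of `W² − 1` —,
slow window, constants) + structural hypotheses + the analytic bricks at RATE grade (`κ, b² = O(λ_b²)`; (B-T) against the dressed one-site form; the dressed near-top amplitude
`hTop`; the dressed one-site no-intruder `hDS`); `softTubeBORatePackageOn_of_rateBricksD` (next file) turns it into `RateTube.SoftTubeBORatePackageOn L χ {orbitDist < δ}`.
[cite: Luscher1983, §3] [cite: SjostrandZworski2007, §2] -/
structure BORateBricksD (χ : ℝ → GaugeConfig 3 L SU2 → ℝ) (δ : ℝ → ℝ) where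
  /-- ADAPTED fibre profile `Ω β u v` (equivariant under global colour rotations) -/
  Ω : ℝ → GaugeConfig 3 1 SU2 → LinkSpace L → ℝ
  /-- DRESSED one-site weight `W β u` (`W² = λ_fib(u)/λ_fib(1)`: adapted-fibre zero-point energy + FP ratio; `> 1` off the vacuum for `L ≥ 3`), bounded measurable -/
  W : ℝ → GaugeConfig 3 1 SU2 → ℝ
  /-- slow window -/
  𝒰 : ℝ → Set (GaugeConfig 3 1 SU2)
  /-- fibre energy factor, fibre mass, relative error, off-diagonal size, lower bound of `χ` on its support -/
  σ : ℝ → ℝ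
  γ : ℝ → ℝ
  κ : ℝ → ℝ
  b : ℝ → ℝ
  c : ℝ → ℝ
  /-- stiff gap, one-site window radius, BO support radius, copy margin -/
  θ₀ : ℝ
  δ₁ : ℝ → ℝ
  δ₂ : ℝ → ℝ
  m : ℝ
  -- structural hypotheses
  hχm : ∀ β, Measurable (χ β)
  hχ1 : ∀ β U, |χ β U| ≤ 1
  hχ0 : ∀ β U, 0 ≤ χ β U
  hc : ∀ β, 0 < c β ∧ ∀ U, χ β U ≠ 0 → c β ≤ χ β U
  hwm : ∀ β, Measurable (softWeight (χ β))
  hwb : ∀ β, ∃ Cw : ℝ, ∀ U, |softWeight (χ β) U| ≤ Cw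
  hw0 : ∀ β U, 0 ≤ softWeight (χ β) U
  hwinv : ∀ β (g : SU2) (U : GaugeConfig 3 L SU2), softWeight (χ β) (gaugeTransform (fun _ : Site 3 L => g) U) = softWeight (χ β) U
  hΩm : ∀ β, Measurable (Function.uncurry (Ω β))
  hΩ1 : ∀ β u x, |Ω β u x| ≤ 1
  hΩinv : ∀ β (g : SU2) (u : GaugeConfig 3 1 SU2) (v : LinkSpace L), Ω β (gaugeTransform (fun _ : Site 3 1 => g) u) (adL L g v) = Ω β u v
  hWm : ∀ β, Measurable (W β)
  hWb : ∀ β, ∃ CW : ℝ, ∀ u, |W β u| ≤ CW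
  h𝒰m : ∀ β, MeasurableSet (𝒰 β)
  h𝒰inv : ∀ β (g : SU2) (u : GaugeConfig 3 1 SU2), gaugeTransform (fun _ : Site 3 1 => g) u ∈ 𝒰 β ↔ u ∈ 𝒰 β
  h𝒰δ₁ : ∀ β, ∀ u ∈ 𝒰 β, orbitDist u < δ₁ β
  hδ₁ : ∀ᶠ β in atTop, δ₁ β ≤ 1 / 2
  htube : ∀ᶠ β in atTop, ∀ U, χ β U ≠ 0 → U ∈ orthoTubeSet L
  hshadow : ∀ᶠ β in atTop, ∀ U, χ β U ≠ 0 → orbitDist U < δ β → slowMean L U ∈ 𝒰 β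
  hbo : ∀ᶠ β in atTop, ∀ (φ : GaugeConfig 3 1 SU2 → ℝ) (U : GaugeConfig 3 L SU2), (∀ u, φ u ≠ 0 → u ∈ 𝒰 β) → boFunAd L φ (Ω β) U ≠ 0 → χ β U ≠ 0 ∧ orbitDist U < δ₂ β
  hm : 0 ≤ m
  hm0 : 0 < m
  hδ₂ : ∀ᶠ β in atTop, (L : ℝ) * (δ₂ β + m) < 2
  hσ : ∀ β, 0 < σ β
  hγ : ∀ β, 0 < γ β
  hκ : ∀ β, 0 ≤ κ β
  hb : ∀ β, 0 ≤ b β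
  hθ₀ : 0 < θ₀ ∧ θ₀ ≤ 1
  hκ_small : ∃ a : ℝ, ∀ᶠ β in atTop, κ β ≤ a * bareLambda ((L : ℝ) ^ 3 * β) ^ 2
  hb_small : ∃ a : ℝ, ∀ᶠ β in atTop, b β ^ 2 ≤ a * bareLambda ((L : ℝ) ^ 3 * β) ^ 2
  -- the analytic bricks (RATE grade: `κ, b² = O(λ_b²)`; DRESSED one-site form `⟨φW, K_BφW⟩`)
  /-- the DRESSED one-site no-intruder at rate grade (every level; norm undressed on the right) -/
  hDS : ∀ k : ℕ, ∃ CD : ℝ, ∀ᶠ β in atTop, ∀ G : Fin (k + 1) → (GaugeConfig 3 1 SU2 → ℝ), (∀ i, Measurable (G i)) → (∀ i, ∃ C : ℝ, ∀ u, |G i u| ≤ C) →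
    (∀ i (g : Site 3 1 → SU2) (u : GaugeConfig 3 1 SU2), G i (gaugeTransform g u) = G i u) → (∀ i u, G i u ≠ 0 → orbitDist u < δ₁ β) →
    (∀ a : Fin (k + 1) → ℝ, a ≠ 0 → 0 < l2 (fun u => (∑ i, a i * G i u) * W β u) (fun u => (∑ i, a i * G i u) * W β u)) →
      ∃ a : Fin (k + 1) → ℝ, a ≠ 0 ∧
        qform su2Rep ((L : ℝ) ^ 3 * β) (fun u => (∑ i, a i * G i u) * W β u) (fun u => (∑ i, a i * G i u) * W β u) * levelValue su2Rep 1 ((L : ℝ) ^ 3 * β) 0 ≤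
          Real.exp (CD * bareLambda ((L : ℝ) ^ 3 * β) ^ 2) * levelValue su2Rep 1 ((L : ℝ) ^ 3 * β) k * levelValue su2Rep 1 ((L : ℝ) ^ 3 * β) 0 *
            l2 (fun u => ∑ i, a i * G i u) (fun u => ∑ i, a i * G i u)
  hTop : ∃ C'' : ℝ, ∀ᶠ β in atTop, ∃ φ₀ : GaugeConfig 3 1 SU2 → ℝ, Measurable φ₀ ∧ (∃ C : ℝ, ∀ u, |φ₀ u| ≤ C) ∧
    (∀ (g : Site 3 1 → SU2) (u : GaugeConfig 3 1 SU2), φ₀ (gaugeTransform g u) = φ₀ u) ∧ (∀ u, φ₀ u ≠ 0 → u ∈ 𝒰 β) ∧ 0 < l2 φ₀ φ₀ ∧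
    Real.exp (-(C'' * bareLambda ((L : ℝ) ^ 3 * β) ^ 2)) * levelValue su2Rep 1 ((L : ℝ) ^ 3 * β) 0 * l2 φ₀ φ₀ ≤
      qform su2Rep ((L : ℝ) ^ 3 * β) (fun u => φ₀ u * W β u) (fun u => φ₀ u * W β u)
  hN : ∀ᶠ β in atTop, ∀ u ∈ 𝒰 β, |fibreMassAd L (softWeight (χ β)) (Ω β) u - γ β| ≤ κ β * γ β
  hT : ∀ᶠ β in atTop, ∀ φ : GaugeConfig 3 1 SU2 → ℝ, Measurable φ → (∃ C : ℝ, ∀ u, |φ u| ≤ C) →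
    (∀ (g : Site 3 1 → SU2) (u : GaugeConfig 3 1 SU2), φ (gaugeTransform g u) = φ u) → (∀ u, φ u ≠ 0 → u ∈ 𝒰 β) →
    |tubeForm β (boFunAd L φ (Ω β)) - σ β * γ β * qform su2Rep ((L : ℝ) ^ 3 * β) (fun u => φ u * W β u) (fun u => φ u * W β u)| ≤
      κ β * (σ β * γ β) * (qform su2Rep ((L : ℝ) ^ 3 * β) (fun u => φ u * W β u) (fun u => φ u * W β u) + levelValue su2Rep 1 ((L : ℝ) ^ 3 * β) 0 * l2 φ φ)
  hST : ∀ᶠ β in atTop, ∀ v : GaugeConfig 3 L SU2 → ℝ, Measurable v → (∃ C : ℝ, ∀ U, |v U| ≤ C) → (∀ U, v U ≠ 0 → χ β U ≠ 0) →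
    (∀ u, fibreInnerAd L (softWeight (χ β)) (Ω β) v u = 0) →
    tubeForm β v ≤ (1 - θ₀) * (σ β * levelValue su2Rep 1 ((L : ℝ) ^ 3 * β) 0) * tubeNormSq (softWeight (χ β)) v
  hOD : ∀ᶠ β in atTop, ∀ (φ : GaugeConfig 3 1 SU2 → ℝ) (v : GaugeConfig 3 L SU2 → ℝ), Measurable φ → (∃ C : ℝ, ∀ u, |φ u| ≤ C) → (∀ u, φ u ≠ 0 → u ∈ 𝒰 β) →
    Measurable v → (∃ C : ℝ, ∀ U, |v U| ≤ C) → (∀ U, v U ≠ 0 → χ β U ≠ 0) → (∀ u, fibreInnerAd L (softWeight (χ β)) (Ω β) v u = 0) →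
    |tubeCross β (boFunAd L φ (Ω β)) v| ≤ b β * (σ β * levelValue su2Rep 1 ((L : ℝ) ^ 3 * β) 0) *
        Real.sqrt (tubeNormSq (softWeight (χ β)) (boFunAd L φ (Ω β))) * Real.sqrt (tubeNormSq (softWeight (χ β)) v) ∧
    |tubeCross β v (boFunAd L φ (Ω β))| ≤ b β * (σ β * levelValue su2Rep 1 ((L : ℝ) ^ 3 * β) 0) *
        Real.sqrt (tubeNormSq (softWeight (χ β)) (boFunAd L φ (Ω β))) * Real.sqrt (tubeNormSq (softWeight (χ β)) v)


end Summit.QuantumFields.YangMills.Theorems.FemtoTransferGap.RateTube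

end
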